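import Summits.BirchSwinnertonDyer.Rank1Residual.Additive.TameBranchAnalyticShaLaw
import Summits.BirchSwinnertonDyer.Rank1Residual.Additive.TameBranchRatCharEqBinderFree
import Summits.BirchSwinnertonDyer.Rank1Residual.Additive.GordBranchPAdicGrossZagier
import Summits.BirchSwinnertonDyer.Rank1Residual.Additive.GordBranchPAdicGrossZagierOdd
import HarnessLib

/-!
# THE A′-INEQUALITY ALONE — rank 1, X4♯(G-ord, `e = 2`) ∩ `I₀*` ∩ {`ρ̄` onto}: Kato 17.4 (3) +
# Delbourgo 2002 (B) + GZK + `[T¹](ϖ·B^±) ≠ 0` + **`v_p([T¹](ϖ·B^±)) + 1 + 2t ≤ v + ord_p ∏c`**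
# (`v ≤ ord_p Reg_p`) ⟹ `TameBranchRatCharEqAt W p`, Schneider, `Ш[p^∞] = 0`, `ord_p Reg_p = v` —
# NO `(μ_an, λ_an)` column; and, GIVEN the typed branch `p`-adic Gross–Zagier formula, the inequality
# IS `ord_p #Ш_an(E) ≤ 0` (cell `b2b-bsdres`, sub-cell additive-p2 = X3♯(G-ord)/X4♯(G-ord), gen 32; part 3)

HONEST FRAMING (cell `b2b-bsdres`, run/shared/lean/b2b/bsd-rank1-residual/, verbatim in every
file): the goal of the cell is to DELETE the COMBINATION-SHAPED residual classes of the
Birch–Swinnerton-Dyer formula for ALL analytic-rank `≤ 1` elliptic curves over `ℚ` — "full BSD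
formula for every rank `≤ 1` curve in class `C`" assembled STRICTLY from published theorems — so
that the rank-`≤ 1` remainder becomes exactly the CONSTRUCTION-SHAPED classes, which are TYPED
(missing-input `Prop`s), NOT attempted. This is not "finishing BSD". Sub-cell additive-p2: the
classes X3♯(G-ord) / X4♯(G-ord) are CONSTRUCTION-SHAPED and stay so; labels / RESIDUAL-MAP marks
UNCHANGED; nothing is booked (`BSD(E,p)` at rank 1 needs the branch `p`-adic Gross–Zagier formula,
which is NOT in print at `p² ∣ N` and enters §3 only as the TYPED hypothesis `BranchPAdicGrossZagier[Odd]At`).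
Theorems only; published inputs are explicit binders (`hK` = Kato 2004 Thm. 17.4 (3) half-eigenspace
reading, `hmodD` = BCDT, `hGZK`, `LeadingTermClauses W p Dh` = Delbourgo 2002 (B) for the datum). No
definition, no named fact, no `sorry`.

## What and why

Gen 31's rank-one full route (`ClassX4Gord.tameBranchRatCharEqAt_of_katoHalf_of_fullSqueeze_rankOne[']`)
needed, per pair, the A′-inequality AND the first unit index `n` of `ϖ·B^±` (the census's
`(μ_an, λ_an)` column); part 1 of gen 32 (`fullSqueeze_rankOne_of_iota_eq`) made the first top automatic.
§1 (core, per twist data / cyclotomic datum): `[T¹](ϖ·B^±) ≠ 0`, `v ≤ ord_p Reg_p(E,Dh)` and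
**`v_p([T¹](ϖ·B^±)) + 1 + 2·ord_p #tors ≤ v + ord_p ∏c`** ⟹ `X` torsion, Schneider, `ord_p Reg_p = v`,
`#Ш(E/ℚ)[p^∞] = 1`, **`char_Λ X = (g)`, `ι g = u·ϖ·B^±`** (the main conjecture (G) at the pair,
INTEGRALLY in E-normalisation). §2 (HEADLINE `ClassX4Gord.tameBranchRatCharEqAt_of_katoHalf_of_linearCoeff
_rankOne`): X4♯(G-ord) ∩ `I₀*` ∩ {`ρ̄` onto}, `p ≥ 5`, `r_an = 1`, a (B)-datum; per pair ONLY `[T¹] ≠ 0`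
and the A′-inequality ⟹ **`TameBranchRatCharEqAt W p`**, Schneider, `ord_p Reg_p = v`, `#Ш[p^∞] = 1` —
the census's `v_p(A′) + 2t = v_h + ord_p(#Ш_an·∏c)` (X4-2 WINDOW 429/429, all `#Ш_an = 1`) is the
hypothesis verbatim GIVEN `Reg_p(⟨,⟩_{p,ℚ}) ↔ h`, with NO `(μ_an, λ_an)` input and no plus-symbol binder.
§3: GIVEN n1011-p01's TYPED branch `p`-adic Gross–Zagier formula for `Dh` (`BranchPAdicGrossZagier[Odd]At`,
conjecture-tagged, NOT in print), `v_p([T¹](ϖ·B^±)) + 1 + 2t = ord_p #Ш_an + ord_p ∏c + ord_p Reg_p(E,Dh)`,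
so `[T¹] ≠ 0` + **`ord_p #Ш_an(E) ≤ 0`** ⟹ `TameBranchRatCharEqAt W p`, Schneider, `#Ш[p^∞] = 1`,
`ord_p #Ш_an = 0`, `BSD(E,p)` (`…_of_branchPAdicGrossZagier_of_shaAn_unit_rankOne`): on these rows the
rational main conjecture at the pair is NOT an input independent of pGZ — pGZ + `p ∤ #Ш_an` give it.
Nothing booked; labels UNCHANGED; the comparison `Reg_p ↔ h` and pGZ remain the located gap at rank 1.

References: Kato 2004 Thm. 17.4 (3) [Kato2004Asterisque]; Delbourgo 2002 Thm. (A), (B) p. 40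
[Delbourgo2002]; Delbourgo 1998 §2.5 BS-D(p) (ii) [Delbourgo1998]; Greenberg LNM 1716 §4
[GreenbergLNM1716]; Mazur–Tate–Teitelbaum 1986 §I.13–I.14 [MazurTateTeitelbaum1986Invent];
Miller 2011 Def. 1.1 [Miller2011LMS]; gen 19 `GordBranchPAdicGrossZagier[Odd].lean`, gen 31 parts 3/8. -/

set_option autoImplicit false

noncomputable section

open scoped Classical MatrixGroups ModularForm NumberField

open CongruenceSubgroup IsDedekindDomain WeierstrassCurve NumberField
  Literature.NumberTheory.EllipticCurves
  Literature.NumberTheory.EllipticCurves.ModularForms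
  Literature.NumberTheory.EllipticCurves.Rank1Residual
  Literature.NumberTheory.EllipticCurves.Rank1Residual.Typed
  Literature.NumberTheory.EllipticCurves.Delbourgo2002
  Literature.NumberTheory.GaloisRepresentations
  Summit.BirchSwinnertonDyer.Rank1Residual.AdditivePotMult
  Summit.BirchSwinnertonDyer.Rank1Residual.X1.MuLambda
  Summit.BirchSwinnertonDyer.Rank1Residual.X1.RankOneParitySqueeze
  Summit.BirchSwinnertonDyer.Rank1Residual.X11a.LambdaNorm

namespace Summit.BirchSwinnertonDyer.Rank1Residual.Additive

/-! ### §1 The core at rank one: `char_Λ X = (Kato element)` from `[T¹] ≠ 0` + the A′-inequality -/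

section ClassLevel

open TameBranchMuPart TameBranchAnalyticSha

variable {W : WeierstrassCurve ℚ} [W.IsElliptic] [W.IsGloballyMinimal] {p : ℕ} [hp : Fact p.Prime]

omit [W.IsGloballyMinimal] in
/-- **THE CORE AT RANK ONE.** X4♯(G-ord) ∩ `I₀*` ∩ {`ρ̄_{E,p}` onto}, `p ≥ 5`, `rank_ℤ E(ℚ) = 1`, a
(B)-datum `Dh`; `V = E♭` globally minimal good ordinary at `p`, `C • V^{(p*)} = W`, `f` a newform of
`V`, `ϖ` the period ratio of the parity of `(p−1)/2`; data: **`[T¹](ϖ·B^±) ≠ 0`**, `v ≤ ord_p Reg_p(E,Dh)`,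
**`v_p([T¹](ϖ·B^±)) + 1 + 2·ord_p #E(ℚ)_tors ≤ v + ord_p ∏c_ℓ`**. Then for every cyclotomic dual datum:
`X` torsion, Schneider, **`ord_p Reg_p(E,Dh) = v`**, **`#Ш(E/ℚ)[p^∞] = 1`**, and a Kato element `g` with
**`char_Λ X = (g)`**, **`ι g = u·ϖ·B^±_{(p−1)/2}(f, α)`** (`u ∈ ℤ_p^×`), every generator `fE` having
`μ(fE) = μ(g)`, `λ(fE) = λ(g)`. NO first-unit-index datum. [cite: Kato2004Asterisque, Thm. 17.4 (3) (p. 273)]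
[cite: Delbourgo2002, Theorem (B) (p. 40)] [cite: GreenbergLNM1716, §4 pp. 102–110] -/
theorem ClassX4Gord.charIdeal_eq_span_kato_of_linearCoeff_rankOne
    (hK : Wuthrich2014.kato_halfEigenCharIdeal_dvd_cyclotomicPrime_of_surjective)
    (hX : ClassX4Gord W p) (hp5 : 5 ≤ p) (hsurj : Surj W p) (hr1 : W.mordellWeilRank = 1)
    {Dh : PAdicHeightData W p} (hBcl : LeadingTermClauses W p Dh)
    (V : WeierstrassCurve ℚ) [V.IsElliptic] [V.IsGloballyMinimal] (C : VariableChange ℚ)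
    (hC : C • V.quadraticTwist ((-1 : ℚ) ^ (p / 2) * p) = W) (hV : GoodOrd V p)
    {N : ℕ} [NeZero N] {f : CuspForm (Gamma0 N) 2} (hf : IsNewformOf V f)
    (ϖ : ℚ) (hϖ : if Even (p / 2) then (ϖ : ℝ) * V.realPeriodRat = plusPeriod f
      else (ϖ : ℝ) * V.imaginaryPeriodRat = minusPeriod f)
    (h1 : PowerSeries.coeff 1 (PowerSeries.C (ϖ : ℚ_[p]) *
      (if Even (p / 2) then padicLFunctionBranch f ((unitRoot V p : ℤ_[p]) : ℚ_[p]) (p / 2)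
        else padicLFunctionMinusBranch f ((unitRoot V p : ℤ_[p]) : ℚ_[p]) (p / 2))) ≠ 0)
    {v : ℤ} (hv : v ≤ (padicRegulator Dh).valuation)
    (hfull : (PowerSeries.coeff 1 (PowerSeries.C (ϖ : ℚ_[p]) *
        (if Even (p / 2) then padicLFunctionBranch f ((unitRoot V p : ℤ_[p]) : ℚ_[p]) (p / 2)
          else padicLFunctionMinusBranch f ((unitRoot V p : ℤ_[p]) : ℚ_[p]) (p / 2)))).valuation +
        1 + 2 * padicValNat p W.torsionOrder ≤ v + padicValNat p W.tamagawaProduct)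
    {κ : ZpExtension ℚ p} {γ : Field.absoluteGaloisGroup ℚ}
    (hκ : κ.IsCyclotomic) (hγ : κ.IsTopGenerator γ) (hγ' : IsCyclotomicVariable p γ)
    (D : W.SelmerDualData κ γ) :
    D.IsTorsion ∧ SchneiderConjecture Dh ∧ (padicRegulator Dh).valuation = v ∧
      Nat.card (AddCommGroup.primaryComponent W.sha p) = 1 ∧
      ∃ (g : IwasawaAlgebra p) (u : ℤ_[p]ˣ), D.charIdeal = Ideal.span {g} ∧
        iwasawaToPowerSeries p g =
          PowerSeries.C (((u : ℤ_[p]) : ℚ_[p]) * (ϖ : ℚ_[p])) *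
            (if Even (p / 2) then padicLFunctionBranch f ((unitRoot V p : ℤ_[p]) : ℚ_[p]) (p / 2)
              else padicLFunctionMinusBranch f ((unitRoot V p : ℤ_[p]) : ℚ_[p]) (p / 2)) ∧
        ∀ fE : IwasawaAlgebra p, D.charIdeal = Ideal.span {fE} → mu fE = mu g ∧ lam fE = lam g := by
  have hp2 : p ≠ 2 := by omega
  have hj := padicValRat_j_nonneg_of_typeGOrd W p hX.typeGOrd
  have hsurjV : ∀ m : ℕ, V.HasSurjectiveModNGaloisRep (p ^ m : ℕ) :=
    X4RankZeroTwistOdd.forall_surj_pow_twist_of_surj W p hp5 V (pStar_ne_zero p) C hC hsurj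
  haveI : Module.Finite (IwasawaAlgebra p) D.X :=
    SelmerDualData.module_finite_of_isCyclotomic (W := W) (κ := κ) hκ D hγ
  obtain ⟨hXt, g, hg, u, hι⟩ := isTorsion_and_exists_iota_eq_branch_of_katoComponent W p
    (Kato2004.charIdeal_dvd_padicLFunctionBranch_component_of_surjective_of_half hK) hj hp2 V
    ⟨C, hC⟩ (Or.inl hV) hsurjV hκ hγ hγ' hf D ϖ hϖ
  have hX1 : PowerSeries.coeff 1 (PowerSeries.C (((u : ℤ_[p]) : ℚ_[p]) * (ϖ : ℚ_[p])) *
      (if Even (p / 2) then padicLFunctionBranch f ((unitRoot V p : ℤ_[p]) : ℚ_[p]) (p / 2)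
        else padicLFunctionMinusBranch f ((unitRoot V p : ℤ_[p]) : ℚ_[p]) (p / 2))) ≠ 0 := by
    rw [PowerSeries.coeff_C_mul, mul_assoc]
    rw [PowerSeries.coeff_C_mul] at h1
    exact mul_ne_zero (coe_units_ne_zero p u) h1
  have hfull' := hfull
  rw [← valuation_coeff_C_unit_mul u _ _ 1 h1] at hfull'
  haveI : (Literature.NumberTheory.EllipticCurves.Module.charIdeal (IwasawaAlgebra p) D.X).IsPrincipal :=
    charIdeal_isPrincipal_holds p D.X
  obtain ⟨fE, hchar⟩ := Submodule.IsPrincipal.principal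
    (Literature.NumberTheory.EllipticCurves.Module.charIdeal (IwasawaAlgebra p) D.X)
  obtain ⟨hS, hspan, -, -, hcard, hReg, -⟩ := fullSqueeze_rankOne_of_iota_eq hp2 hr1 hBcl hκ hγ hγ' D
    hXt hchar hg hι hX1 hv hfull'
  refine ⟨hXt, hS, hReg, hcard, g, u, hspan, hι, fun fE' hchar' ↦ ?_⟩
  obtain ⟨-, -, hμ, hlam, -⟩ := fullSqueeze_rankOne_of_iota_eq hp2 hr1 hBcl hκ hγ hγ' D hXt hchar' hg hι
    hX1 hv hfull'
  exact ⟨hμ, hlam⟩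

/-! ### §2 The headline at rank one: the A′-inequality alone -/

/-- **HEADLINE, RANK ONE: THE A′-INEQUALITY ALONE.** X4♯(G-ord) ∩ `I₀*` ∩ {`ρ̄_{E,p}` onto}, `p ≥ 5`,
`ord_{s=1} L(E,s) = 1`, a (B)-datum `Dh` (in print Delbourgo's `⟨,⟩_{p,ℚ}`), a certified
`v ≤ ord_p Reg_p(E,Dh)`; per pair, for the twist data, ONLY **`[T¹](ϖ·B^±) ≠ 0`** and
**`v_p([T¹](ϖ·B^±)) + 1 + 2·ord_p #tors ≤ v + ord_p ∏c_ℓ`** (census: `v_p(A′) + 2t ≤ v_h + ord_p ∏c`,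
an EQUALITY on 429/429 defect-2 window rows). Then **`TameBranchRatCharEqAt W p`**, Schneider,
**`ord_p Reg_p(E,Dh) = v`**, **`#Ш(E/ℚ)[p^∞] = 1`**. Inputs: Kato 17.4 (3), (B), GZK, BCDT — no parity,
no `(μ_an, λ_an)` column, no plus-symbol binder. [cite: Kato2004Asterisque, Thm. 17.4 (3) (p. 273)]
[cite: Delbourgo2002, Theorem (B) (p. 40)] [cite: GreenbergLNM1716, §4 pp. 102–110] -/
theorem ClassX4Gord.tameBranchRatCharEqAt_of_katoHalf_of_linearCoeff_rankOne
    (hK : Wuthrich2014.kato_halfEigenCharIdeal_dvd_cyclotomicPrime_of_surjective)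
    (hmodD : nonempty_modularParametrizationData)
    (hGZK : rank_eq_analyticRank_of_analyticRank_le_one)
    (hX : ClassX4Gord W p) (hp5 : 5 ≤ p) (he : semistabilityIndex W p = 2) (hsurj : Surj W p)
    (hr : W.analyticRank = 1) {Dh : PAdicHeightData W p} (hBcl : LeadingTermClauses W p Dh)
    {v : ℤ} (hv : v ≤ (padicRegulator Dh).valuation)
    (hcert : ∀ (V : WeierstrassCurve ℚ) [V.IsElliptic] [V.IsGloballyMinimal] (C : VariableChange ℚ),
      C • V.quadraticTwist ((-1 : ℚ) ^ (p / 2) * p) = W → IsOrdinaryAt V p →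
      ∀ {N : ℕ} [NeZero N] (f : CuspForm (Gamma0 N) 2), IsNewformOf V f →
      ∀ ϖ : ℚ, (if Even (p / 2) then (ϖ : ℝ) * V.realPeriodRat = plusPeriod f
          else (ϖ : ℝ) * V.imaginaryPeriodRat = minusPeriod f) →
        PowerSeries.coeff 1 (PowerSeries.C (ϖ : ℚ_[p]) *
            (if Even (p / 2) then padicLFunctionBranch f ((unitRoot V p : ℤ_[p]) : ℚ_[p]) (p / 2)
              else padicLFunctionMinusBranch f ((unitRoot V p : ℤ_[p]) : ℚ_[p]) (p / 2))) ≠ 0 ∧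
        (PowerSeries.coeff 1 (PowerSeries.C (ϖ : ℚ_[p]) *
            (if Even (p / 2) then padicLFunctionBranch f ((unitRoot V p : ℤ_[p]) : ℚ_[p]) (p / 2)
              else padicLFunctionMinusBranch f ((unitRoot V p : ℤ_[p]) : ℚ_[p]) (p / 2)))).valuation +
            1 + 2 * padicValNat p W.torsionOrder ≤ v + padicValNat p W.tamagawaProduct) :
    TameBranchRatCharEqAt W p ∧ SchneiderConjecture Dh ∧ (padicRegulator Dh).valuation = v ∧
      Nat.card (AddCommGroup.primaryComponent W.sha p) = 1 := by
  have hp2 : p ≠ 2 := by omega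
  obtain ⟨hmw, -⟩ := hGZK W (by rw [hr])
  have hr1 : W.mordellWeilRank = 1 := by rw [hmw, hr]
  obtain ⟨V, iV, iVm, C, hV, hC⟩ := hX.exists_goodOrd_pStar_twist_model W p he
  haveI : NeZero (V.conductorNorm ℤ) := ⟨(V.conductorNorm_pos_holds).ne'⟩
  obtain ⟨Dm⟩ := hmodD V
  obtain ⟨ϖ, hϖ⟩ := exists_periodRatio_parity (p := p) V Dm
  have hj := padicValRat_j_nonneg_of_typeGOrd W p hX.typeGOrd
  have hord : IsOrdinaryAt V p :=
    isOrdinaryAt_of_goodOrd_or_mult_of_model_twist W V (pStar_ne_zero p) ⟨C, hC⟩ hj (Or.inl hV)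
  obtain ⟨h1, hfull⟩ := hcert V C hC hord Dm.f Dm.isNewformOf ϖ hϖ
  have hϖ0 : ϖ ≠ 0 := by
    rintro rfl; apply h1; rw [Rat.cast_zero, map_zero, zero_mul, map_zero]
  have hB0 : (if Even (p / 2) then padicLFunctionBranch Dm.f ((unitRoot V p : ℤ_[p]) : ℚ_[p]) (p / 2)
      else padicLFunctionMinusBranch Dm.f ((unitRoot V p : ℤ_[p]) : ℚ_[p]) (p / 2)) ≠ 0 := by
    intro e; apply h1; rw [e, mul_zero, map_zero]
  have core := fun {κ : ZpExtension ℚ p} {γ : Field.absoluteGaloisGroup ℚ} (hκ : κ.IsCyclotomic)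
      (hγ : κ.IsTopGenerator γ) (hγ' : IsCyclotomicVariable p γ) (D : W.SelmerDualData κ γ) ↦
    hX.charIdeal_eq_span_kato_of_linearCoeff_rankOne hK hp5 hsurj hr1 hBcl V C hC hV Dm.isNewformOf ϖ hϖ
      h1 hv hfull hκ hγ hγ' D
  obtain ⟨κ₀, γ₀, hκ₀, hγ₀, hγ₀', D₀, -, -⟩ := exists_cyclotomic_dualData_generator W p
  obtain ⟨-, hS, hReg, hcard, -⟩ := core hκ₀ hγ₀ hγ₀' D₀
  refine ⟨?_, hS, hReg, hcard⟩
  intro κ γ N _ f ε α B _ haddv _ hκ hγ hcv hf _ hα hB D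
  obtain ⟨hXt, -, -, -, g₁, u, hspan, hι, -⟩ := core hκ hγ hcv D
  exact ⟨hXt, exists_charIdeal_eq_span_and_iota_eq_of_generator hp2 V C hC haddv hV hf
    (exists_ratPlusSymbol_ne_zero_of_isNewformOf hf) Dm hϖ0 hspan hι hB0 hα hB⟩

/-! ### §3 GIVEN the typed branch `p`-adic Gross–Zagier formula: the inequality IS `ord_p #Ш_an ≤ 0` -/

omit [W.IsGloballyMinimal] in
/-- **The `T¹`-dictionary under the typed branch `p`-adic Gross–Zagier formula.** For the twist data
`(V, C, f, ϖ)` of an additive `W` at `p ≠ 2` with `rank_ℤ E(ℚ) = 1` and a height datum `Dh`: IF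
`BranchPAdicGrossZagierAt W p Dh` (`p ≡ 1 (mod 4)`) / `BranchPAdicGrossZagierOddAt W p Dh`
(`p ≡ 3 (mod 4)`) hold and `[T¹](ϖ·B^±) ≠ 0`, then with `#Ш_an(E) = s ∈ ℚ`:
**`v_p([T¹](ϖ·B^±)) + 1 + 2·ord_p #E(ℚ)_tors = ord_p s + ord_p ∏c_ℓ + ord_p Reg_p(E,Dh)`** and
`Reg_p(E,Dh) ≠ 0`. (`#Ш_an = (L'(E,1)/(Ω·Reg))·#T²/∏c`, `v_p(log_p γ) = 1`.) The pGZ formula is a TYPED,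
conjecture-tagged input of n1011-p01 / gen 19, NOT in print at `p² ∣ N`. [cite: Delbourgo1998, §2.5 BS-D(p) (ii) (pp. 151–152) (shape only)]
[cite: Miller2011LMS, §1 (arXiv:1010.2431 p. 3)] -/
theorem valuation_coeff_one_branch_add_eq_of_branchPAdicGrossZagier (hp2 : p ≠ 2)
    (hr1 : W.mordellWeilRank = 1) {Dh : PAdicHeightData W p}
    (hGZe : BranchPAdicGrossZagierAt W p Dh) (hGZo : BranchPAdicGrossZagierOddAt W p Dh)
    (V : WeierstrassCurve ℚ) [V.IsElliptic] [V.IsGloballyMinimal] (C : VariableChange ℚ)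
    (hC : C • V.quadraticTwist ((-1 : ℚ) ^ (p / 2) * p) = W) (hV : GoodOrd V p)
    {N : ℕ} [NeZero N] {f : CuspForm (Gamma0 N) 2} (hf : IsNewformOf V f)
    (ϖ : ℚ) (hϖ : if Even (p / 2) then (ϖ : ℝ) * V.realPeriodRat = plusPeriod f
      else (ϖ : ℝ) * V.imaginaryPeriodRat = minusPeriod f)
    (h1 : PowerSeries.coeff 1 (PowerSeries.C (ϖ : ℚ_[p]) *
      (if Even (p / 2) then padicLFunctionBranch f ((unitRoot V p : ℤ_[p]) : ℚ_[p]) (p / 2)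
        else padicLFunctionMinusBranch f ((unitRoot V p : ℤ_[p]) : ℚ_[p]) (p / 2))) ≠ 0)
    {s : ℚ} (hs : shaAn W = (s : ℂ)) :
    padicRegulator Dh ≠ 0 ∧
      (PowerSeries.coeff 1 (PowerSeries.C (ϖ : ℚ_[p]) *
          (if Even (p / 2) then padicLFunctionBranch f ((unitRoot V p : ℤ_[p]) : ℚ_[p]) (p / 2)
            else padicLFunctionMinusBranch f ((unitRoot V p : ℤ_[p]) : ℚ_[p]) (p / 2)))).valuation +
          1 + 2 * padicValNat p W.torsionOrder =
        padicValRat p s + padicValNat p W.tamagawaProduct + (padicRegulator Dh).valuation := by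
  have hpQ : (p : ℚ_[p]) ≠ 0 := Nat.cast_ne_zero.mpr hp.out.ne_zero
  have hΩ : (W.realPeriodRat : ℂ) ≠ 0 := by exact_mod_cast W.realPeriodRat_pos_holds.ne'
  have hR : (W.regulator : ℂ) ≠ 0 := by exact_mod_cast W.regulator_pos'.ne'
  have hT0 : (W.torsionOrder : ℚ) ≠ 0 := by exact_mod_cast W.torsionOrder_pos_holds.ne'
  have hc0 : (W.tamagawaProduct : ℚ) ≠ 0 := by
    exact_mod_cast (W.tamagawaProduct_pos_holds : 0 < W.tamagawaProduct).ne'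
  -- the typed formula, in either parity, read at `r = 1`
  have key : ∃ (u : ℤ_[p]ˣ) (q : ℚ),
      W.leadingLCoeff = (q : ℂ) * (W.realPeriodRat : ℂ) * (W.regulator : ℂ) ∧
      PowerSeries.coeff 1 (PowerSeries.C (ϖ : ℚ_[p]) *
          (if Even (p / 2) then padicLFunctionBranch f ((unitRoot V p : ℤ_[p]) : ℚ_[p]) (p / 2)
            else padicLFunctionMinusBranch f ((unitRoot V p : ℤ_[p]) : ℚ_[p]) (p / 2))) *
          padicLog p (cyclotomicGenerator p) =
        ((u : ℤ_[p]) : ℚ_[p]) * (q : ℚ_[p]) * padicRegulator Dh := by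
    have hodd : p % 4 = 1 ∨ p % 4 = 3 := by
      obtain ⟨k, hk⟩ := hp.out.odd_of_ne_two hp2
      omega
    rcases hodd with h4 | h4
    · have heven : Even (p / 2) := ⟨p / 4, by omega⟩
      have hC' : C • V.quadraticTwist (p : ℚ) = W := by
        have e : ((-1 : ℚ) ^ (p / 2) * p) = (p : ℚ) := by rw [heven.neg_one_pow, one_mul]
        rw [e] at hC
        exact hC
      rw [if_pos heven] at hϖ ⊢
      obtain ⟨u, q, hL, hGZ⟩ := hGZe V h4 ⟨C, hC'⟩ hV hf ϖ hϖ
      refine ⟨u, q, hL, ?_⟩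
      rw [hr1, pow_one] at hGZ; rw [PowerSeries.coeff_C_mul, ← hGZ]
    · have ho : Odd (p / 2) := ⟨p / 4, by omega⟩
      have hnot : ¬ Even (p / 2) := Nat.not_even_iff_odd.mpr ho
      have hC' : C • V.quadraticTwist (-(p : ℚ)) = W := by
        have e : ((-1 : ℚ) ^ (p / 2) * p) = -(p : ℚ) := by rw [ho.neg_one_pow, neg_one_mul]
        rw [e] at hC
        exact hC
      rw [if_neg hnot] at hϖ ⊢
      obtain ⟨u, q, hL, hGZ⟩ := hGZo V h4 ⟨C, hC'⟩ hV hf ϖ hϖ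
      refine ⟨u, q, hL, ?_⟩
      rw [hr1, pow_one] at hGZ; rw [PowerSeries.coeff_C_mul, ← hGZ]
  obtain ⟨u, q, hL, hGZ⟩ := key
  -- `s = q · #T² / ∏c`
  have hcC : (W.tamagawaProduct : ℂ) ≠ 0 := by
    exact_mod_cast (W.tamagawaProduct_pos_holds : 0 < W.tamagawaProduct).ne'
  have hs' : s = q * (W.torsionOrder : ℚ) ^ 2 / (W.tamagawaProduct : ℚ) := by
    have e : shaAn W = ((q * (W.torsionOrder : ℚ) ^ 2 / (W.tamagawaProduct : ℚ) : ℚ) : ℂ) := by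
      rw [shaAn_def, hL]
      push_cast
      field_simp
    exact_mod_cast hs.symm.trans e
  -- valuations
  obtain ⟨w, hw⟩ := exists_unit_padicLog_cyclotomicGenerator (p := p) hp2
  have hlog0 : padicLog p (cyclotomicGenerator p : ℚ_[p]) ≠ 0 := by
    rw [hw]; exact mul_ne_zero hpQ (coe_units_ne_zero p w)
  have hlogv : (padicLog p (cyclotomicGenerator p : ℚ_[p])).valuation = 1 := by
    rw [hw, Padic.valuation_mul hpQ (coe_units_ne_zero p w), Padic.valuation_p,
      valuation_coe_units_eq_zero, add_zero]
  have hlhs0 := mul_ne_zero h1 hlog0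
  rw [hGZ] at hlhs0
  have hqR0 : (q : ℚ_[p]) * padicRegulator Dh ≠ 0 := by
    intro e; apply hlhs0; rw [mul_assoc, e, mul_zero]
  have hq0 : (q : ℚ_[p]) ≠ 0 := left_ne_zero_of_mul hqR0
  have hReg0 : padicRegulator Dh ≠ 0 := right_ne_zero_of_mul hqR0
  have hq0' : q ≠ 0 := by rintro rfl; exact hq0 Rat.cast_zero
  refine ⟨hReg0, ?_⟩
  have hval := congrArg Padic.valuation hGZ
  rw [Padic.valuation_mul h1 hlog0, hlogv, Padic.valuation_mul (mul_ne_zero (coe_units_ne_zero p u) hq0)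
    hReg0, Padic.valuation_mul (coe_units_ne_zero p u) hq0, valuation_coe_units_eq_zero, zero_add,
    Padic.valuation_ratCast] at hval
  rw [hs', padicValRat.div (mul_ne_zero hq0' (pow_ne_zero 2 hT0)) hc0, padicValRat.mul hq0' (pow_ne_zero 2 hT0),
    padicValRat.pow, padicValRat.of_nat, padicValRat.of_nat]
  push_cast
  linarith

/-- **RANK ONE, GIVEN THE BRANCH `p`-ADIC GROSS–ZAGIER FORMULA: `p ∤ #Ш_an(E)` CERTIFIES THE MAIN
CONJECTURE AT THE PAIR AND `BSD(E,p)`.** X4♯(G-ord) ∩ `I₀*` ∩ {`ρ̄_{E,p}` onto}, `p ≥ 5`,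
`ord_{s=1} L(E,s) = 1`, a (B)-datum `Dh` for which n1011-p01's typed `BranchPAdicGrossZagier[Odd]At W p Dh`
holds (NOT in print; construction-shaped); per pair ONLY **`[T¹](ϖ·B^±) ≠ 0`** (simple analytic zero);
and **`ord_p #Ш_an(E) ≤ 0`**. Then **`TameBranchRatCharEqAt W p`**, Schneider, **`#Ш(E/ℚ)[p^∞] = 1`**,
**`ord_p #Ш_an(E) = 0`**, **`BSD(E,p)`**. So on these rows pGZ + `p ∤ #Ш_an` ⟹ the rational main
conjecture at the pair: the two typed rank-one inputs of RESIDUAL-MAP O7-ord are not independent.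
[cite: Kato2004Asterisque, Thm. 17.4 (3) (p. 273)] [cite: Delbourgo2002, Theorem (B) (p. 40)]
[cite: Delbourgo1998, §2.5 BS-D(p) (ii) (shape only)] [cite: Miller2011LMS, Def. 1.1 (arXiv:1010.2431 p. 3)] -/
theorem ClassX4Gord.tameBranchRatCharEqAt_and_bsdp_of_branchPAdicGrossZagier_of_shaAn_unit_rankOne
    (hK : Wuthrich2014.kato_halfEigenCharIdeal_dvd_cyclotomicPrime_of_surjective)
    (hmodD : nonempty_modularParametrizationData)
    (hGZK : rank_eq_analyticRank_of_analyticRank_le_one)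
    (hX : ClassX4Gord W p) (hp5 : 5 ≤ p) (he : semistabilityIndex W p = 2) (hsurj : Surj W p)
    (hr : W.analyticRank = 1) {Dh : PAdicHeightData W p} (hBcl : LeadingTermClauses W p Dh)
    (hGZe : BranchPAdicGrossZagierAt W p Dh) (hGZo : BranchPAdicGrossZagierOddAt W p Dh)
    (hcert : ∀ (V : WeierstrassCurve ℚ) [V.IsElliptic] [V.IsGloballyMinimal] (C : VariableChange ℚ),
      C • V.quadraticTwist ((-1 : ℚ) ^ (p / 2) * p) = W → IsOrdinaryAt V p →
      ∀ {N : ℕ} [NeZero N] (f : CuspForm (Gamma0 N) 2), IsNewformOf V f →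
      ∀ ϖ : ℚ, (if Even (p / 2) then (ϖ : ℝ) * V.realPeriodRat = plusPeriod f
          else (ϖ : ℝ) * V.imaginaryPeriodRat = minusPeriod f) →
        PowerSeries.coeff 1 (PowerSeries.C (ϖ : ℚ_[p]) *
            (if Even (p / 2) then padicLFunctionBranch f ((unitRoot V p : ℤ_[p]) : ℚ_[p]) (p / 2)
              else padicLFunctionMinusBranch f ((unitRoot V p : ℤ_[p]) : ℚ_[p]) (p / 2))) ≠ 0)
    {s : ℚ} (hs : shaAn W = (s : ℂ)) (hsv : padicValRat p s ≤ 0) :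
    TameBranchRatCharEqAt W p ∧ SchneiderConjecture Dh ∧
      Nat.card (AddCommGroup.primaryComponent W.sha p) = 1 ∧ padicValRat p s = 0 ∧ BSDp W p := by
  have hp2 : p ≠ 2 := by omega
  obtain ⟨hmw, -⟩ := hGZK W (by rw [hr])
  have hr1 : W.mordellWeilRank = 1 := by rw [hmw, hr]
  obtain ⟨V, iV, iVm, C, hV, hC⟩ := hX.exists_goodOrd_pStar_twist_model W p he
  haveI : NeZero (V.conductorNorm ℤ) := ⟨(V.conductorNorm_pos_holds).ne'⟩
  obtain ⟨Dm⟩ := hmodD V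
  obtain ⟨ϖ, hϖ⟩ := exists_periodRatio_parity (p := p) V Dm
  have hj := padicValRat_j_nonneg_of_typeGOrd W p hX.typeGOrd
  have hord : IsOrdinaryAt V p :=
    isOrdinaryAt_of_goodOrd_or_mult_of_model_twist W V (pStar_ne_zero p) ⟨C, hC⟩ hj (Or.inl hV)
  have h1 := hcert V C hC hord Dm.f Dm.isNewformOf ϖ hϖ
  obtain ⟨hReg0, hdict⟩ := valuation_coeff_one_branch_add_eq_of_branchPAdicGrossZagier hp2 hr1 hGZe hGZo
    V C hC hV Dm.isNewformOf ϖ hϖ h1 hs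
  have hfull : (PowerSeries.coeff 1 (PowerSeries.C (ϖ : ℚ_[p]) *
      (if Even (p / 2) then padicLFunctionBranch Dm.f ((unitRoot V p : ℤ_[p]) : ℚ_[p]) (p / 2)
        else padicLFunctionMinusBranch Dm.f ((unitRoot V p : ℤ_[p]) : ℚ_[p]) (p / 2)))).valuation +
      1 + 2 * padicValNat p W.torsionOrder ≤
        (padicRegulator Dh).valuation + padicValNat p W.tamagawaProduct := by
    rw [hdict]; linarith
  have hϖ0 : ϖ ≠ 0 := by
    rintro rfl; apply h1; rw [Rat.cast_zero, map_zero, zero_mul, map_zero]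
  have hB0 : (if Even (p / 2) then padicLFunctionBranch Dm.f ((unitRoot V p : ℤ_[p]) : ℚ_[p]) (p / 2)
      else padicLFunctionMinusBranch Dm.f ((unitRoot V p : ℤ_[p]) : ℚ_[p]) (p / 2)) ≠ 0 := by
    intro e; apply h1; rw [e, mul_zero, map_zero]
  have core := fun {κ : ZpExtension ℚ p} {γ : Field.absoluteGaloisGroup ℚ} (hκ : κ.IsCyclotomic)
      (hγ : κ.IsTopGenerator γ) (hγ' : IsCyclotomicVariable p γ) (D : W.SelmerDualData κ γ) ↦
    hX.charIdeal_eq_span_kato_of_linearCoeff_rankOne hK hp5 hsurj hr1 hBcl V C hC hV Dm.isNewformOf ϖ hϖ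
      h1 le_rfl hfull hκ hγ hγ' D
  -- one cyclotomic datum: Schneider, `#Ш[p^∞] = 1`, and `ord_p s = 0` from clause 3 for the Kato generator
  obtain ⟨κ₀, γ₀, hκ₀, hγ₀, hγ₀', D₀, -, -⟩ := exists_cyclotomic_dualData_generator W p
  haveI : Module.Finite (IwasawaAlgebra p) D₀.X :=
    SelmerDualData.module_finite_of_isCyclotomic (W := W) (κ := κ₀) hκ₀ D₀ hγ₀
  obtain ⟨hXt₀, hS, -, hcard, g, u, hspan, hι, -⟩ := core hκ₀ hγ₀ hγ₀' D₀
  haveI : Finite (AddCommGroup.primaryComponent W.sha p) :=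
    Nat.finite_of_card_ne_zero (by rw [hcard]; exact one_ne_zero)
  have hs0 : padicValRat p s = 0 := by
    have hX1 : PowerSeries.coeff 1 (PowerSeries.C (((u : ℤ_[p]) : ℚ_[p]) * (ϖ : ℚ_[p])) *
        (if Even (p / 2) then padicLFunctionBranch Dm.f ((unitRoot V p : ℤ_[p]) : ℚ_[p]) (p / 2)
          else padicLFunctionMinusBranch Dm.f ((unitRoot V p : ℤ_[p]) : ℚ_[p]) (p / 2))) ≠ 0 := by
      rw [PowerSeries.coeff_C_mul, mul_assoc]
      rw [PowerSeries.coeff_C_mul] at h1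
      exact mul_ne_zero (coe_units_ne_zero p u) h1
    have hfull' := hfull
    rw [← valuation_coeff_C_unit_mul u _ _ 1 h1] at hfull'
    obtain ⟨-, -, -, -, -, -, hcoef, hℓ⟩ := fullSqueeze_rankOne_of_iota_eq hp2 hr1 hBcl hκ₀ hγ₀ hγ₀' D₀
      hXt₀ hspan (by rw [hspan]; exact Ideal.mem_span_singleton_self g) hι hX1 le_rfl hfull'
    obtain ⟨-, -, hcl3⟩ := hBcl κ₀ γ₀ hκ₀ hγ₀ hγ₀' D₀ hXt₀ g hspan
    obtain ⟨u', ℓ, hℓp, -, heq⟩ := hcl3 hS ‹_›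
    have hℓ1 : ℓ = 1 := hℓ u' ℓ hℓp heq
    rw [hr1, hℓ1, hcard] at heq
    have hg1 : ((PowerSeries.coeff 1 g : ℤ_[p]) : ℚ_[p]) ≠ 0 := by
      rw [← Wuthrich2014.coeff_iwasawaToPowerSeries p g 1, hι]; exact hX1
    have hval := TameBranchFullSqueeze.valuation_eq_of_clause_three (W := W) hp2 hg1 hReg0
      (ℓ := 1) (S := 1) one_ne_zero one_ne_zero heq
    rw [hcoef, valuation_coeff_C_unit_mul u _ _ 1 h1, padicValNat_one_right] at hval
    push_cast at hval hdict
    linarith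
  refine ⟨?_, hS, hcard, hs0, ⟨hmw, ‹_›, s, hs, by rw [hs0, hcard, padicValNat_one_right, Nat.cast_zero]⟩⟩
  intro κ γ N _ f ε α B _ haddv _ hκ hγ hcv hf _ hα hB D
  obtain ⟨hXt, -, -, -, g₁, u₁, hspan₁, hι₁, -⟩ := core hκ hγ hcv D
  exact ⟨hXt, exists_charIdeal_eq_span_and_iota_eq_of_generator hp2 V C hC haddv hV hf
    (exists_ratPlusSymbol_ne_zero_of_isNewformOf hf) Dm hϖ0 hspan₁ hι₁ hB0 hα hB⟩

end ClassLevel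

end Summit.BirchSwinnertonDyer.Rank1Residual.Additive

end
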